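import Mathlib
import Summits.QuantumFields.YangMills.Theorems.GronwallGapContinuumFromLatticeGapDockSWS
import Summits.QuantumFields.YangMills.Theorems.GapAtCorrelationLength.Negative.GapAtCorrelationLengthFalseOfLightFluxGroup
import HarnessLib

/-!
# `ContinuumFromLatticeGap` (stmt-QuantumFields-15915) — negative side: COLD PRESSURE AT THE LOCK kills the route's
# own lattice leg at every light-flux group

Support file for the crux item stmt-QuantumFields-15915 (`GronwallGap.ContinuumFromLatticeGap`, route `GronwallGap`,
rank 4), line `registered` (reshape 4, skeleton `Cruxes/ContinuumFromLatticeGap/Lines/birth.lean`), namespace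
`…Theorems.ContinuumFromLatticeGap.Negative`.  It settles the status of the line's registered open stub
`stub_coldPressureAtLock` (trace-excess bound of the cold tori along every scheme pinned to a UNIFORM lock) INSIDE THE
ROUTE: together with `DirichletWindow.XiDiverges` (stmt-QuantumFields-8941, a named hypothesis of the line) the stub
contradicts, at every admissible gauge group with a light-flux mode (`GapAtCorrelationLength.Negative.LightFluxMode`,
the hypothesis of W₁'s landed negative lemma p148067; `SO(3)` is admissible by the landed `isCompactSimpleLieGroup_SO3`),
the `G`-instance of the route's rank-0 TARGET `GronwallGap.LatticeGapOffTransitions` — which is verbatim the hypothesis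
the crux feeds on.  So the stub is not merely unproved: modulo `LightFluxMode SO(3)` ('t Hooft's light magnetic flux in
the confined phase, physics-certain, rigorously open) it refutes the very lattice leg route `GronwallGap` bets on, and the
composition `ContinuumFromLatticeGap_of` is vacuous at every light-flux group.

Mechanism (pure bookkeeping over landed pieces): the crux hypothesis at `(G, r)` and `XiDiverges` give the lock OFF the
exceptional set (`stub_lockOffE`, p147376) and criticality of the locked rates (`stub_criticalOfLock`, p147095); the unit
`a_k := m̂_k / 2` is pinned (`Δ₀ = 1`, `φ = id`), the volumes `L_k := S₁ k ∨ ⌈a_k⁻²⌉₊` are polynomial (`a_k⁻¹ ≤ a_k L_k`);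
the bare scheme on these data (`stub_bareScheme`, p155657) is fed to the stub (cold pressure) and to the landed
`stub_rpSpectralOfColdPressure` (p155090), which returns W₁'s RP-spectral conjunct (b) over the GLOBAL slab class along a
scheme with `β_k → ∞`; and (b) along any such scheme is incompatible with a light-flux mode
(`rpSpectral_eventually_false_of_lightFlux`, the bookkeeping of `gapAtCorrelationLength_false_of_lightFluxMode` factored
out: at a step `k` with the clause active and `β_k` in the light-flux regime put `ε := Δ a_k / 8`, take the flux witness
`(S, T, n, Y)` beyond `N₀ ∨ L_k`, and compare `e^{−εS} ≤ cov ≤ e^{−Δ a_k S/4} + |C| e^{−Δ a_k S} < e^{−εS}`).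

Contents: `rpSpectral_eventually_false_of_lightFlux` (core, generic measurable structure, light-flux hypothesis at one
`r` spelled out), `latticeGapAt_false_of_coldPressureAtLock` (cold pressure at the lock → `XiDiverges` → at an admissible
light-flux `G`, NO faithful `r` has the all-`β`-off-`E` volume-uniform gap), and the `stub_false` forms
`coldPressureAtLock_false_of_latticeGapAt` (¬stub from the gap at ONE `r` of a light-flux `G`),
`coldPressureAtLock_false_of_latticeGapOffTransitions` (¬stub from the route decl `GronwallGap.LatticeGapOffTransitions`,
`XiDiverges` and a light-flux admissible group), `…_SO3` (the `SO(3)` specialisation).  The cold-pressure statement is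
VERBATIM the registered signature of `stub_coldPressureAtLock` (as hypothesis `hCP`, resp. negated).  No definitions, no named
facts, no `sorry`; axioms `propext`, `Classical.choice`, `Quot.sound`.  References (context): G. 't Hooft, Nucl. Phys.
B153 (1979) 141; C. Borgs, E. Seiler, CMP 91 (1983) 329 §II; P. de Forcrand, O. Jahn, Nucl. Phys. B651 (2003) 125 §4, §6.
-/

noncomputable section

open scoped SchwartzMap BigOperators Topology
open MeasureTheory Filter Set Function
open Literature.MathematicalPhysics.QuantumFieldTheory Literature.MathematicalPhysics.QuantumLattice
  Literature.MathematicalPhysics.AQFT Literature.Probability.LatticeModels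
open Literature.AlgebraicTopology.FundamentalGroup (SO3)
open Summit.QuantumFields.YangMills.Theorems.NonSimplyConnectedLatticeGap
  (so3_isTopologicalGroup so3_compactSpace isCompactSimpleLieGroup_SO3)
open Summit.QuantumFields.YangMills.Theorems.GapAtCorrelationLength.Negative (LightFluxMode)
open Summit.QuantumFields.YangMills.Theorems.ContinuumLegGivenGap (cscl_tendsto_mul_of_pow)

namespace Summit.QuantumFields.YangMills.Theorems.ContinuumFromLatticeGap.Negative

open Summit.QuantumFields.YangMills.Theses (GronwallGap.LatticeGapOffTransitions DirichletWindow.XiDiverges)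

section Core

variable {G : Type} [Group G] [TopologicalSpace G] [IsTopologicalGroup G] [CompactSpace G]
  [MeasurableSpace G] [BorelSpace G]

/-- **W₁'s RP-spectral conjunct along a weak-coupling scheme is incompatible with a light-flux mode at its
representation** (the bookkeeping of `gapAtCorrelationLength_false_of_lightFluxMode`, factored out).  If at every large
coupling, for every rate `ε > 0` and beyond every size, some odd torus carries a bounded measurable slab functional `Y`,
`|Y| ≤ 1`, with reflected time-`n` covariance `≥ e^{−εS}` at a separation `n ≥ S/4`, then no scheme with `β_k → +∞`
satisfies, eventually in `k`, the relative clustering `|⟨ΘY·τ_nY⟩ − ⟨Y⟩²| ≤ e^{−Δ a_k n}(⟨ΘY·Y⟩ − ⟨Y⟩²) + C B² e^{−Δ a_k S₀}`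
over all such `Y` on all tori `S₀ ≥ L_k` with `Δ > 0`. [folklore] -/
theorem rpSpectral_eventually_false_of_lightFlux (r : LatticeRep G) (sch : SpeciesScheme (YMSpecies G))
    (hw : Tendsto sch.β atTop atTop) {Δ : ℝ} (hΔ : 0 < Δ) (C : ℝ)
    (hH : ∀ᶠ β : ℝ in atTop, ∀ ε : ℝ, 0 < ε → ∀ M₀ : ℕ,
      ∃ (S T n : ℕ), M₀ ≤ S ∧ 2 * (T + n + 1) ≤ S ∧ S ≤ 4 * n ∧
      ∃ (Y : LGConfig 4 G → ℝ), Measurable Y ∧ (∀ U, |Y U| ≤ 1) ∧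
        DependsOn Y {e : Literature.MathematicalPhysics.QuantumLattice.ZdEdge 4 |
          1 ≤ e.1 0 ∧ e.1 0 + (if e.2 = 0 then 1 else 0) ≤ T} ∧
        Real.exp (-(ε * S)) ≤
          (∫ U, Y (torusLift (2 * S + 1) (GaugeConfig.timeReflect U)) *
              Y (configShift (-Pi.single 0 (n : ℤ)) (torusLift (2 * S + 1) U))
              ∂(wilsonMeasure r.ρ β : Measure (GaugeConfig 4 (2 * S + 1) G))) -
          (∫ U, Y (torusLift (2 * S + 1) U)
              ∂(wilsonMeasure r.ρ β : Measure (GaugeConfig 4 (2 * S + 1) G))) ^ 2) :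
    ¬ (∀ᶠ k in atTop, ∀ (S₀ T₀ n : ℕ), sch.L k ≤ S₀ → 2 * (T₀ + n + 1) ≤ S₀ →
        ∀ (Y : LGConfig 4 G → ℝ) (B : ℝ), Measurable Y → (∀ U, |Y U| ≤ B) →
          DependsOn Y {e : Literature.MathematicalPhysics.QuantumLattice.ZdEdge 4 |
            1 ≤ e.1 0 ∧ e.1 0 + (if e.2 = 0 then 1 else 0) ≤ T₀} →
          |(∫ U, Y (torusLift (2 * S₀ + 1) (GaugeConfig.timeReflect U)) *
                Y (configShift (-Pi.single 0 (n : ℤ)) (torusLift (2 * S₀ + 1) U))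
              ∂(wilsonMeasure r.ρ (sch.β k) : Measure (GaugeConfig 4 (2 * S₀ + 1) G))) -
            (∫ U, Y (torusLift (2 * S₀ + 1) U)
              ∂(wilsonMeasure r.ρ (sch.β k) : Measure (GaugeConfig 4 (2 * S₀ + 1) G))) ^ 2| ≤
            Real.exp (-(Δ * sch.a k * n)) *
              ((∫ U, Y (torusLift (2 * S₀ + 1) (GaugeConfig.timeReflect U)) * Y (torusLift (2 * S₀ + 1) U)
                  ∂(wilsonMeasure r.ρ (sch.β k) : Measure (GaugeConfig 4 (2 * S₀ + 1) G))) -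
                (∫ U, Y (torusLift (2 * S₀ + 1) U)
                  ∂(wilsonMeasure r.ρ (sch.β k) : Measure (GaugeConfig 4 (2 * S₀ + 1) G))) ^ 2) +
            C * B ^ 2 * Real.exp (-(Δ * sch.a k * S₀))) := by
  intro hRP
  -- a step `k` at which the clause is active and the coupling is in the light-flux regime
  obtain ⟨k, hRPk, hβk⟩ := (hRP.and (hw.eventually hH)).exists
  have ha : 0 < sch.a k := sch.a_pos k
  have hΔa : 0 < Δ * sch.a k := mul_pos hΔ ha
  -- the rate of the witness: ε := Δ a_k / 8
  set ε : ℝ := Δ * sch.a k / 8 with hε_def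
  have hε : 0 < ε := by positivity
  -- h(S) := e^{-Δ a S/8} + |C| e^{-7 Δ a S/8} → 0
  set h : ℝ → ℝ := fun x =>
      Real.exp (-(Δ * sch.a k * x / 8)) + |C| * Real.exp (-(7 * (Δ * sch.a k) * x / 8)) with hh_def
  have hh : Tendsto h atTop (𝓝 0) := by
    have h1 : Tendsto (fun x : ℝ => Δ * sch.a k * x / 8) atTop atTop :=
      (tendsto_id.const_mul_atTop hΔa).atTop_div_const (by norm_num)
    have h7 : Tendsto (fun x : ℝ => 7 * (Δ * sch.a k) * x / 8) atTop atTop :=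
      (tendsto_id.const_mul_atTop (by positivity : (0:ℝ) < 7 * (Δ * sch.a k))).atTop_div_const
        (by norm_num)
    have e1 : Tendsto (fun x : ℝ => Real.exp (-(Δ * sch.a k * x / 8))) atTop (𝓝 0) :=
      Real.tendsto_exp_atBot.comp (tendsto_neg_atTop_atBot.comp h1)
    have e2 : Tendsto (fun x : ℝ => |C| * Real.exp (-(7 * (Δ * sch.a k) * x / 8))) atTop
        (𝓝 (|C| * 0)) :=
      (Real.tendsto_exp_atBot.comp (tendsto_neg_atTop_atBot.comp h7)).const_mul |C|
    simpa [hh_def] using e1.add e2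
  have hhN : Tendsto (fun S : ℕ => h S) atTop (𝓝 0) := hh.comp tendsto_natCast_atTop_atTop
  obtain ⟨N₀, hN₀⟩ := eventually_atTop.1 (hhN.eventually (gt_mem_nhds (by norm_num : (0:ℝ) < 1)))
  -- the witness on a torus beyond `max N₀ L_k`
  obtain ⟨S, T, n, hMS, h2, h4, Y, hYm, hYb, hYdep, hcov⟩ := hβk ε hε (max N₀ (sch.L k))
  have hLS : sch.L k ≤ S := (le_max_right _ _).trans hMS
  have hNS : N₀ ≤ S := (le_max_left _ _).trans hMS
  have key := hRPk S T n hLS h2 Y 1 hYm hYb hYdep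
  -- `⟨ΘY · Y⟩ ≤ 1`: `|Y| ≤ 1` under a probability measure
  haveI : IsProbabilityMeasure (wilsonMeasure (d := 4) (L := 2 * S + 1) (G := G) r.ρ (sch.β k)) :=
    isProbabilityMeasure_wilsonMeasure r.ρ r.continuous _
  have hI0 : (∫ U, Y (torusLift (2 * S + 1) (GaugeConfig.timeReflect U)) * Y (torusLift (2 * S + 1) U)
      ∂(wilsonMeasure r.ρ (sch.β k) : Measure (GaugeConfig 4 (2 * S + 1) G))) ≤ 1 := by
    have hb : ∀ U : GaugeConfig 4 (2 * S + 1) G,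
        ‖Y (torusLift (2 * S + 1) (GaugeConfig.timeReflect U)) * Y (torusLift (2 * S + 1) U)‖ ≤ 1 := by
      intro U
      rw [Real.norm_eq_abs, abs_mul]
      have h₁ := hYb (torusLift (2 * S + 1) (GaugeConfig.timeReflect U))
      have h₂ := hYb (torusLift (2 * S + 1) U)
      have h₃ := abs_nonneg (Y (torusLift (2 * S + 1) (GaugeConfig.timeReflect U)))
      nlinarith
    have hint := norm_integral_le_of_norm_le_const
      (μ := (wilsonMeasure r.ρ (sch.β k) : Measure (GaugeConfig 4 (2 * S + 1) G)))
      (Eventually.of_forall hb)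
    simp only [probReal_univ, mul_one, Real.norm_eq_abs] at hint
    exact (le_abs_self _).trans hint
  generalize hIn_def : (∫ U, Y (torusLift (2 * S + 1) (GaugeConfig.timeReflect U)) *
      Y (configShift (-Pi.single 0 (n : ℤ)) (torusLift (2 * S + 1) U))
      ∂(wilsonMeasure r.ρ (sch.β k) : Measure (GaugeConfig 4 (2 * S + 1) G))) = In at key hcov
  generalize hI0_def : (∫ U, Y (torusLift (2 * S + 1) (GaugeConfig.timeReflect U)) *
      Y (torusLift (2 * S + 1) U)
      ∂(wilsonMeasure r.ρ (sch.β k) : Measure (GaugeConfig 4 (2 * S + 1) G))) = I0 at key hI0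
  generalize hm_def : (∫ U, Y (torusLift (2 * S + 1) U)
      ∂(wilsonMeasure r.ρ (sch.β k) : Measure (GaugeConfig 4 (2 * S + 1) G))) = m at key hcov
  -- exponent algebra: e^{-Δ a n} ≤ e^{-Δ a S/4} = e^{-εS} e^{-Δ a S/8},  e^{-Δ a S} = e^{-εS} e^{-7Δ a S/8}
  have hS4 : (S : ℝ) ≤ 4 * n := by exact_mod_cast h4
  have hexp_n : Real.exp (-(Δ * sch.a k * n)) ≤ Real.exp (-(Δ * sch.a k * S / 4)) := by
    apply Real.exp_le_exp.2
    nlinarith [mul_le_mul_of_nonneg_left hS4 hΔa.le]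
  have hsplit4 : Real.exp (-(Δ * sch.a k * S / 4)) =
      Real.exp (-(ε * S)) * Real.exp (-(Δ * sch.a k * S / 8)) := by
    rw [← Real.exp_add, hε_def]; ring_nf
  have hsplit1 : Real.exp (-(Δ * sch.a k * S)) =
      Real.exp (-(ε * S)) * Real.exp (-(7 * (Δ * sch.a k) * S / 8)) := by
    rw [← Real.exp_add, hε_def]; ring_nf
  have hE : 0 < Real.exp (-(ε * S)) := Real.exp_pos _
  have hexp0 : 0 ≤ Real.exp (-(Δ * sch.a k * n)) := Real.exp_nonneg _
  have hdiff : I0 - m ^ 2 ≤ 1 := by nlinarith [sq_nonneg m]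
  -- upper bound from the clause
  have hup : In - m ^ 2 ≤ Real.exp (-(ε * S)) * h S := by
    have t1 : Real.exp (-(Δ * sch.a k * n)) * (I0 - m ^ 2) ≤
        Real.exp (-(ε * S)) * Real.exp (-(Δ * sch.a k * S / 8)) := by
      calc Real.exp (-(Δ * sch.a k * n)) * (I0 - m ^ 2)
          ≤ Real.exp (-(Δ * sch.a k * n)) * 1 := mul_le_mul_of_nonneg_left hdiff hexp0
        _ ≤ Real.exp (-(Δ * sch.a k * S / 4)) := by simpa using hexp_n
        _ = _ := hsplit4
    have t2 : C * (1 : ℝ) ^ 2 * Real.exp (-(Δ * sch.a k * S)) ≤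
        Real.exp (-(ε * S)) * (|C| * Real.exp (-(7 * (Δ * sch.a k) * S / 8))) := by
      rw [hsplit1]
      have hC := le_abs_self C
      have hE7 : 0 ≤ Real.exp (-(7 * (Δ * sch.a k) * S / 8)) := Real.exp_nonneg _
      nlinarith [mul_nonneg hE.le hE7]
    have hlhs : In - m ^ 2 ≤ |In - m ^ 2| := le_abs_self _
    have : In - m ^ 2 ≤ Real.exp (-(ε * S)) * Real.exp (-(Δ * sch.a k * S / 8)) +
        Real.exp (-(ε * S)) * (|C| * Real.exp (-(7 * (Δ * sch.a k) * S / 8))) := by linarith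
    simpa [hh_def, mul_add] using this
  -- lower bound from the witness and the contradiction `e^{-εS} ≤ In - m² ≤ e^{-εS} h S < e^{-εS}`
  have hhS : h S < 1 := hN₀ S hNS
  have : Real.exp (-(ε * S)) * h S < Real.exp (-(ε * S)) * 1 := mul_lt_mul_of_pos_left hhS hE
  linarith

end Core

/-- **Cold pressure at the lock refutes the lattice gap at every light-flux group.**  Assume the registered open stub
`stub_coldPressureAtLock` of line `registered` (its signature VERBATIM, as the hypothesis `hCP`: the trace excess of the
cold tori `(m+2) × (2S+1)³`, `S ≥ L_k`, `S + 1 ≤ 2(m+2)`, is eventually `≤ C₀ (2S+1)³ e^{−Δ₁ a_k (m+2)}` at some rate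
`0 < Δ₁ ≤ Δ₀` along EVERY scheme pinned to a UNIFORM lock at weak coupling) and `DirichletWindow.XiDiverges`
(stmt-QuantumFields-8941).  Then at every admissible `G` with a light-flux mode NO faithful lattice representation `r`
has the all-`β`-off-`E` volume-uniform lattice gap — the `(G, r)`-instance of the route's target
`GronwallGap.LatticeGapOffTransitions`, i.e. the hypothesis of the crux `ContinuumFromLatticeGap` at `G`.  Proof: the gap
at `(G, r)` and `XiDiverges` give the lock off `E` and criticality (landed `stub_lockOffE`, `stub_criticalOfLock`); pin
`a_k := m̂_k/2` (`Δ₀ = 1`, `φ = id`), `L_k := S₁ k ∨ ⌈a_k⁻²⌉₊` (`a_k⁻¹ ≤ a_k L_k`), take the bare scheme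
(`stub_bareScheme`); `hCP` gives cold pressure, the landed `stub_rpSpectralOfColdPressure` gives W₁'s RP-spectral
conjunct along a scheme with `β_k → ∞`, and `rpSpectral_eventually_false_of_lightFlux` the contradiction. [folklore] -/
theorem latticeGapAt_false_of_coldPressureAtLock
    (hCP : ∀ (G : Type) [Group G] [TopologicalSpace G] [IsTopologicalGroup G] [CompactSpace G]
      [MeasurableSpace G] [BorelSpace G], IsCompactSimpleLieGroup G → ∀ (r : LatticeRep G)
      (β : ℕ → ℝ) (mh : ℕ → ℝ) (S₁ : ℕ → ℕ), Tendsto β atTop atTop → (∀ k, 0 < mh k) →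
      (∀ A B : YMSpecies G, ∃ C : ℝ, ∀ k S n : ℕ, S₁ k ≤ S → n ≤ S →
        |latticeConnectedCorr r.ρ (β k) (2 * S + 1) A.F B.F n| ≤ C * Real.exp (-(mh k * n))) →
      ∀ (sch : SpeciesScheme (YMSpecies G)) (φ : ℕ → ℕ) (Δ₀ : ℝ), StrictMono φ → 0 < Δ₀ →
        (∀ k, sch.β k = β (φ k)) → (∀ k, Δ₀ * sch.a k ≤ mh (φ k)) → (∀ k, S₁ (φ k) ≤ sch.L k) →
        (∃ N : ℕ, 1 ≤ N ∧ ∀ᶠ k in atTop, (sch.a k)⁻¹ ≤ (sch.a k * (sch.L k : ℝ)) ^ N) →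
        ∃ C₀ Δ₁ : ℝ, 0 ≤ C₀ ∧ 0 < Δ₁ ∧ Δ₁ ≤ Δ₀ ∧
          ∀ᶠ k in atTop, ∀ S : ℕ, sch.L k ≤ S → ∀ m : ℕ, S + 1 ≤ 2 * (m + 2) →
            traceExcess r.ρ (sch.β k) (2 * S + 1) (m + 2) ≤
              C₀ * ((2 * S + 1 : ℕ) : ℝ) ^ 3 * Real.exp (-(Δ₁ * sch.a k * ((m + 2 : ℕ) : ℝ))))
    (hXi : DirichletWindow.XiDiverges)
    (G : Type) [Group G] [TopologicalSpace G] [IsTopologicalGroup G] [CompactSpace G]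
    (hG : IsCompactSimpleLieGroup G) (hH : LightFluxMode G) :
    letI : MeasurableSpace G := borel G
    haveI : BorelSpace G := ⟨rfl⟩
    ∀ r : LatticeRep G,
      ¬ (∃ E : Set ℝ, (∀ b : ℝ, (E ∩ Set.Icc 0 b).Finite) ∧ ∀ β : ℝ, 0 < β → β ∉ E → ∃ m : ℝ, 0 < m ∧
          ∀ A B : YMSpecies G, ∃ C : ℝ, ∃ S₀ : ℕ, ∀ S : ℕ, S₀ ≤ S → ∀ n : ℕ, n ≤ S →
            |latticeConnectedCorr r.ρ β (2 * S + 1) A.F B.F n| ≤ C * Real.exp (-(m * n))) := by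
  letI : MeasurableSpace G := borel G
  haveI : BorelSpace G := ⟨rfl⟩
  intro r hgap
  -- the lock off the exceptional set and criticality of the locked rates (landed IR leg of the line)
  obtain ⟨β, mh, S₁, K, hβ, hmh, -, hUNIF, -⟩ := stub_lockOffE hXi G hG r hgap
  have hcrit : Tendsto mh atTop (𝓝 0) := stub_criticalOfLock hXi G hG r β mh S₁ hβ hmh hUNIF
  -- the pinned unit `a_k := m̂_k / 2` and polynomial volumes `L_k := S₁ k ∨ ⌈a_k⁻²⌉₊`
  set a : ℕ → ℝ := fun k => mh k / 2 with ha_def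
  have ha : ∀ k, 0 < a k := fun k => by simp only [ha_def]; exact half_pos (hmh k)
  have hpin : ∀ k, (1 : ℝ) * a k ≤ mh (id k) := fun k => by
    simp only [ha_def, one_mul, id]; linarith [hmh k]
  have ha0 : Tendsto a atTop (𝓝 0) := stub_unitToZero a mh id 1 ha strictMono_id one_pos hpin hcrit
  set L : ℕ → ℕ := fun k => max (S₁ k) ⌈((a k)⁻¹) ^ 2⌉₊ with hL_def
  have hLS : ∀ k, S₁ (id k) ≤ L k := fun k => le_max_left _ _
  have hL : ∀ k, (a k)⁻¹ ≤ a k * (L k : ℝ) := fun k => by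
    have h1 : ((a k)⁻¹) ^ 2 ≤ (L k : ℝ) := by
      have : ((⌈((a k)⁻¹) ^ 2⌉₊ : ℕ) : ℝ) ≤ (L k : ℝ) := by
        simp only [hL_def]; exact_mod_cast le_max_right _ _
      exact (Nat.le_ceil _).trans this
    have hak : a k ≠ 0 := (ha k).ne'
    calc (a k)⁻¹ = a k * ((a k)⁻¹) ^ 2 := by field_simp
      _ ≤ a k * (L k : ℝ) := mul_le_mul_of_nonneg_left h1 (ha k).le
  have hpow : ∀ᶠ k in atTop, (a k)⁻¹ ≤ (a k * (L k : ℝ)) ^ 1 :=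
    Eventually.of_forall fun k => by rw [pow_one]; exact hL k
  have hLt : Tendsto (fun k => a k * (L k : ℝ)) atTop atTop := cscl_tendsto_mul_of_pow le_rfl ha ha0 hpow
  -- the bare scheme on the locked data
  obtain ⟨sch, hsa, hsβ, hsL, -, -⟩ := stub_bareScheme G a β L ha ha0 hLt
  have hsβ' : ∀ k, sch.β k = β (id k) := fun k => hsβ k
  have hpin' : ∀ k, (1 : ℝ) * sch.a k ≤ mh (id k) := fun k => by rw [hsa k]; exact hpin k
  have hLS' : ∀ k, S₁ (id k) ≤ sch.L k := fun k => by rw [hsL k]; exact hLS k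
  have hpv : ∃ N : ℕ, 1 ≤ N ∧ ∀ᶠ k in atTop, (sch.a k)⁻¹ ≤ (sch.a k * (sch.L k : ℝ)) ^ N :=
    ⟨1, le_rfl, hpow.mono fun k hk => by rw [hsa k, hsL k]; exact hk⟩
  have hw : Tendsto sch.β atTop atTop := by
    rw [show sch.β = β from funext hsβ]; exact hβ
  -- cold pressure at the lock (the stub) ⇒ W₁'s RP-spectral conjunct along `sch` (landed) ⇒ contradiction
  have hcp := hCP G hG r β mh S₁ hβ hmh hUNIF sch id 1 strictMono_id one_pos hsβ' hpin' hLS' hpv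
  obtain ⟨Δ, C, hΔ, -, hrp⟩ :=
    stub_rpSpectralOfColdPressure G hG r β mh S₁ hβ hmh hUNIF sch id 1 strictMono_id one_pos hsβ' hpin' hLS'
      hpv hcp
  exact rpSpectral_eventually_false_of_lightFlux r sch hw hΔ C (hH r) hrp

/-- **The registered stub is false at any light-flux group carrying the lattice gap** (the `stub_coldPressureAtLock_false`
form, modulo named hypotheses only).  Given `DirichletWindow.XiDiverges` (stmt-QuantumFields-8941), an admissible `G` with
a light-flux mode (`LightFluxMode G`, the hypothesis of W₁'s landed negative lemma; intended inhabitant `SO(3)`) and ONE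
faithful `r` of `G` with the all-`β`-off-`E` volume-uniform lattice gap (the `(G, r)`-instance of the route's target
`GronwallGap.LatticeGapOffTransitions` = the crux's hypothesis at `G`), the statement registered as `stub_coldPressureAtLock`
(VERBATIM, negated here) is false.  Contrapositive of `latticeGapAt_false_of_coldPressureAtLock`. [folklore] -/
theorem coldPressureAtLock_false_of_latticeGapAt (hXi : DirichletWindow.XiDiverges)
    (G : Type) [Group G] [TopologicalSpace G] [IsTopologicalGroup G] [CompactSpace G]
    (hG : IsCompactSimpleLieGroup G) (hH : LightFluxMode G)
    (hgap : letI : MeasurableSpace G := borel G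
      haveI : BorelSpace G := ⟨rfl⟩
      ∃ r : LatticeRep G, ∃ E : Set ℝ, (∀ b : ℝ, (E ∩ Set.Icc 0 b).Finite) ∧
        ∀ β : ℝ, 0 < β → β ∉ E → ∃ m : ℝ, 0 < m ∧
          ∀ A B : YMSpecies G, ∃ C : ℝ, ∃ S₀ : ℕ, ∀ S : ℕ, S₀ ≤ S → ∀ n : ℕ, n ≤ S →
            |latticeConnectedCorr r.ρ β (2 * S + 1) A.F B.F n| ≤ C * Real.exp (-(m * n))) :
    ¬ (∀ (G : Type) [Group G] [TopologicalSpace G] [IsTopologicalGroup G] [CompactSpace G]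
      [MeasurableSpace G] [BorelSpace G], IsCompactSimpleLieGroup G → ∀ (r : LatticeRep G)
      (β : ℕ → ℝ) (mh : ℕ → ℝ) (S₁ : ℕ → ℕ), Tendsto β atTop atTop → (∀ k, 0 < mh k) →
      (∀ A B : YMSpecies G, ∃ C : ℝ, ∀ k S n : ℕ, S₁ k ≤ S → n ≤ S →
        |latticeConnectedCorr r.ρ (β k) (2 * S + 1) A.F B.F n| ≤ C * Real.exp (-(mh k * n))) →
      ∀ (sch : SpeciesScheme (YMSpecies G)) (φ : ℕ → ℕ) (Δ₀ : ℝ), StrictMono φ → 0 < Δ₀ →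
        (∀ k, sch.β k = β (φ k)) → (∀ k, Δ₀ * sch.a k ≤ mh (φ k)) → (∀ k, S₁ (φ k) ≤ sch.L k) →
        (∃ N : ℕ, 1 ≤ N ∧ ∀ᶠ k in atTop, (sch.a k)⁻¹ ≤ (sch.a k * (sch.L k : ℝ)) ^ N) →
        ∃ C₀ Δ₁ : ℝ, 0 ≤ C₀ ∧ 0 < Δ₁ ∧ Δ₁ ≤ Δ₀ ∧
          ∀ᶠ k in atTop, ∀ S : ℕ, sch.L k ≤ S → ∀ m : ℕ, S + 1 ≤ 2 * (m + 2) →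
            traceExcess r.ρ (sch.β k) (2 * S + 1) (m + 2) ≤
              C₀ * ((2 * S + 1 : ℕ) : ℝ) ^ 3 * Real.exp (-(Δ₁ * sch.a k * ((m + 2 : ℕ) : ℝ)))) := by
  intro hCP
  letI : MeasurableSpace G := borel G
  haveI : BorelSpace G := ⟨rfl⟩
  obtain ⟨r, hr⟩ := hgap
  exact latticeGapAt_false_of_coldPressureAtLock hCP hXi G hG hH r hr

/-- **The registered stub is false modulo the route's own target** (packaged over the route decl): under
`GronwallGap.LatticeGapOffTransitions` (stmt-QuantumFields-8799, the rank-0 target of route `GronwallGap` — exactly what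
the crux's hypothesis instantiates), `DirichletWindow.XiDiverges` (stmt-QuantumFields-8941) and ONE admissible gauge group
with a light-flux mode, the statement registered as `stub_coldPressureAtLock` is false.  Upshot for the planners: no line
serving THIS route may carry the stub as typed; the repair is the summit-wide restate of W₁'s conjunct (b) / `IRInputs`
(b) over the LOCAL functional class, after which the stub becomes "local RP-spectral clustering at the lock" (cold
pressure itself — a bound on the FULL trace — stays global and stays refuted here). [folklore] -/
theorem coldPressureAtLock_false_of_latticeGapOffTransitions (hT : GronwallGap.LatticeGapOffTransitions)
    (hXi : DirichletWindow.XiDiverges)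
    (G : Type) [Group G] [TopologicalSpace G] [IsTopologicalGroup G] [CompactSpace G]
    (hG : IsCompactSimpleLieGroup G) (hH : LightFluxMode G) :
    ¬ (∀ (G : Type) [Group G] [TopologicalSpace G] [IsTopologicalGroup G] [CompactSpace G]
      [MeasurableSpace G] [BorelSpace G], IsCompactSimpleLieGroup G → ∀ (r : LatticeRep G)
      (β : ℕ → ℝ) (mh : ℕ → ℝ) (S₁ : ℕ → ℕ), Tendsto β atTop atTop → (∀ k, 0 < mh k) →
      (∀ A B : YMSpecies G, ∃ C : ℝ, ∀ k S n : ℕ, S₁ k ≤ S → n ≤ S →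
        |latticeConnectedCorr r.ρ (β k) (2 * S + 1) A.F B.F n| ≤ C * Real.exp (-(mh k * n))) →
      ∀ (sch : SpeciesScheme (YMSpecies G)) (φ : ℕ → ℕ) (Δ₀ : ℝ), StrictMono φ → 0 < Δ₀ →
        (∀ k, sch.β k = β (φ k)) → (∀ k, Δ₀ * sch.a k ≤ mh (φ k)) → (∀ k, S₁ (φ k) ≤ sch.L k) →
        (∃ N : ℕ, 1 ≤ N ∧ ∀ᶠ k in atTop, (sch.a k)⁻¹ ≤ (sch.a k * (sch.L k : ℝ)) ^ N) →
        ∃ C₀ Δ₁ : ℝ, 0 ≤ C₀ ∧ 0 < Δ₁ ∧ Δ₁ ≤ Δ₀ ∧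
          ∀ᶠ k in atTop, ∀ S : ℕ, sch.L k ≤ S → ∀ m : ℕ, S + 1 ≤ 2 * (m + 2) →
            traceExcess r.ρ (sch.β k) (2 * S + 1) (m + 2) ≤
              C₀ * ((2 * S + 1 : ℕ) : ℝ) ^ 3 * Real.exp (-(Δ₁ * sch.a k * ((m + 2 : ℕ) : ℝ)))) := by
  obtain ⟨r⟩ := hG.2
  exact coldPressureAtLock_false_of_latticeGapAt hXi G hG hH ⟨r, hT G hG r⟩

/-- **`SO(3)` specialisation.**  `SO(3)` is admissible (`isCompactSimpleLieGroup_SO3`, landed, with the landed instances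
`so3_isTopologicalGroup`, `so3_compactSpace`); so the route's target, `DirichletWindow.XiDiverges` and a light-flux mode
of `SO(3)` ('t Hooft's light ℤ₂ magnetic flux at weak coupling — the intended inhabitant of W₁'s `LightFluxGroup`) refute
the statement registered as `stub_coldPressureAtLock`. [folklore] -/
theorem coldPressureAtLock_false_of_latticeGapOffTransitions_SO3 (hT : GronwallGap.LatticeGapOffTransitions)
    (hXi : DirichletWindow.XiDiverges) (hH : @LightFluxMode SO3 _ _ so3_isTopologicalGroup so3_compactSpace) :
    ¬ (∀ (G : Type) [Group G] [TopologicalSpace G] [IsTopologicalGroup G] [CompactSpace G]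
      [MeasurableSpace G] [BorelSpace G], IsCompactSimpleLieGroup G → ∀ (r : LatticeRep G)
      (β : ℕ → ℝ) (mh : ℕ → ℝ) (S₁ : ℕ → ℕ), Tendsto β atTop atTop → (∀ k, 0 < mh k) →
      (∀ A B : YMSpecies G, ∃ C : ℝ, ∀ k S n : ℕ, S₁ k ≤ S → n ≤ S →
        |latticeConnectedCorr r.ρ (β k) (2 * S + 1) A.F B.F n| ≤ C * Real.exp (-(mh k * n))) →
      ∀ (sch : SpeciesScheme (YMSpecies G)) (φ : ℕ → ℕ) (Δ₀ : ℝ), StrictMono φ → 0 < Δ₀ →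
        (∀ k, sch.β k = β (φ k)) → (∀ k, Δ₀ * sch.a k ≤ mh (φ k)) → (∀ k, S₁ (φ k) ≤ sch.L k) →
        (∃ N : ℕ, 1 ≤ N ∧ ∀ᶠ k in atTop, (sch.a k)⁻¹ ≤ (sch.a k * (sch.L k : ℝ)) ^ N) →
        ∃ C₀ Δ₁ : ℝ, 0 ≤ C₀ ∧ 0 < Δ₁ ∧ Δ₁ ≤ Δ₀ ∧
          ∀ᶠ k in atTop, ∀ S : ℕ, sch.L k ≤ S → ∀ m : ℕ, S + 1 ≤ 2 * (m + 2) →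
            traceExcess r.ρ (sch.β k) (2 * S + 1) (m + 2) ≤
              C₀ * ((2 * S + 1 : ℕ) : ℝ) ^ 3 * Real.exp (-(Δ₁ * sch.a k * ((m + 2 : ℕ) : ℝ)))) :=
  @coldPressureAtLock_false_of_latticeGapOffTransitions hT hXi SO3 _ _ so3_isTopologicalGroup so3_compactSpace
    isCompactSimpleLieGroup_SO3 hH

end Summit.QuantumFields.YangMills.Theorems.ContinuumFromLatticeGap.Negative

end
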